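/-
Copyright (c) 2026. All rights reserved.
Released under Apache 2.0 license as described in the file LICENSE.
Authors: abc-iut cell, fact-proving seat abc-iut-f-102 (block F, tranche 102).
-/
import Literature.AnabelianGeometry.AbsoluteAnabelian.LogFrobeniusShiftActionInvariance
import Literature.AnabelianGeometry.AbsoluteAnabelian.LogFrobeniusLogWallIndependence
import HarnessLib

/-!
# [AbsTopIII] Corollary 5.5 (v) at the diagonal setting, part 1: every shift is COMPATIBLE (Def 3.5 (v)) with the family of strict commutations (towards the instance forms of FACT-LIST rows F-0157 / F-0156)

S. Mochizuki, *Topics in absolute anabelian geometry III: global reconstruction algorithms*,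
J. Math. Sci. Univ. Tokyo 22 (2015) 939–1156 [MochizukiAbsTopIII2015]; locators `p.N` = pages of the
author's manuscript (`paper:url-5493eb38cbb7`): Def 3.5 (ii), (iii), (v) pp. 75–77 (families of homotopies, cores,
1-morphisms and their compatibility with families of homotopies), Cor 5.5 (i) p. 130, (iii) p. 131, (v) pp. 131–133
(proof p. 133: "the remainder of assertion (v) is immediate from the definitions and constructions made thus far").

PROOF-ONLY companion (no `def`, nothing restated) of `LogFrobeniusRigidity.lean` (abc-iut-L4-t3: `Cor55ShiftAction` = F-0157,
`Cor55Rigidity` = F-0156, `RealisesCor55Families` = F-0159), of abc-iut-w5-d112's `LogFrobeniusRigidityProofs.lean`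
(`cor55ShiftAction_iff`, `shiftOneMorphism_iso_eq`) and of abc-iut-w4-d095's `LogFrobeniusLogWallIndependence.lean` /
`LogFrobeniusCor55FamiliesDiagonal.lean` (the DIAGONAL setting `diagonal Vmod isArc C` on a large category `C` — every row
`C`, every structure functor `𝟭 C`, every 2-cell an identity — with its family of strict commutations `diagonalFamily` of
ALL co-verticial pairs of `D•⊢`, which REALISES the cores of Cor 5.5 (i) and the observables of Cor 5.5 (iii) for
`V(F_mod) ≠ ∅`: `diagonal_realisesCor55Families`, the instance form of F-0159).  Contents:

* (toolkit used: this seat's `DiagramMorphismPathIso.lean` — the isomorphisms `Φ_{[γ]}` of a 1-morphism along paths with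
  `eqToHom` components for strictly commuting 1-morphisms — and `LogFrobeniusShiftActionInvariance.lean` — the shift of
  `Γ⃗_{D•⊢}` is surjective on paths, `DVertex.shiftGraph_mapPath_cast`; compatibility = shift-invariance);
* `nonempty_diagonalShiftCompatibleWith k` — at the diagonal setting every shift `Φ = shiftOneMorphism k` is COMPATIBLE
  (Def 3.5 (v)) with `diagonalFamily`: the boundary set (all pairs) is shift-invariant, and the homotopies (`eqToHom`) commute with the
  `Φ_{[γ]}` (`eqToHom`);
* `diagonal_cor55CoreRigid_iff` — total `□`-rigidity at the diagonal setting iff `C` is id-rigid (named form).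
Part 2 (`LogFrobeniusShiftActionDiagonal.lean`, after abc-iut-w4-d095's `LogFrobeniusCor55FamiliesDiagonal.lean`:
`diagonal_realisesCor55Families`, F-0159) assembles `diagonal_cor55ShiftAction` (F-0157) and `diagonal_cor55Rigidity_iff` (F-0156).

With `LogFrobeniusShiftActionNecessity.lean` / `LogFrobeniusShiftActionIotaIso.lean` (this seat: the rows FAIL over the
empty index set and at the zero-twisted setting over every nonempty one) this completes the kernel status of F-0156 /
F-0157 (and, with w4-d095's file, F-0159): INDEPENDENT of the interface `LogFrobeniusSetting`, satisfiable exactly when `V(F_mod) ≠ ∅`; R5 —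
consumable at NAMED instances only.  HONEST LABEL: the diagonal setting is a DEGENERATE calibration device (no arithmetic
content); "holds at the diagonal setting" certifies consistency of the typed statement with the interface, nothing about
print's `Th•_T[Z]`.  Refereed pre-IUT anabelian geometry; nothing here bears on [IUTchIII] Cor. 3.12; typed ≠ proved.
-/

set_option autoImplicit false

universe v u w

open CategoryTheory Quiver

namespace Literature.AnabelianGeometry.AbsoluteAnabelian

/-! ## Bookkeeping: morphisms that are `eqToHom`s -/

section EqToHomLike

variable {C : Type*} [Category C] {C' : Type*} [Category C']

/-- a composite of two `eqToHom`s is an `eqToHom`. [folklore] -/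
private theorem exists_eqToHom_comp {X Y Z : C} {f : X ⟶ Y} {g : Y ⟶ Z} (hf : ∃ h, f = eqToHom h)
    (hg : ∃ h, g = eqToHom h) : ∃ h, f ≫ g = eqToHom h := by
  obtain ⟨p, rfl⟩ := hf
  obtain ⟨q, rfl⟩ := hg
  exact ⟨p.trans q, eqToHom_trans p q⟩

/-- a functor maps an `eqToHom` to an `eqToHom`. [folklore] -/
private theorem exists_eqToHom_map (G : C ⥤ C') {X Y : C} {f : X ⟶ Y} (hf : ∃ h, f = eqToHom h) :
    ∃ h, G.map f = eqToHom h := by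
  obtain ⟨p, rfl⟩ := hf
  exact ⟨congrArg G.obj p, eqToHom_map G p⟩

/-- a component of an `eqToHom` between functors is an `eqToHom`. [folklore] -/
private theorem exists_eqToHom_app {A : Type*} [Category A] {F G : A ⥤ C} {α : F ⟶ G} (hα : ∃ H, α = eqToHom H)
    (X : A) : ∃ h, α.app X = eqToHom h := by
  obtain ⟨p, rfl⟩ := hα
  exact ⟨Functor.congr_obj p X, eqToHom_app p X⟩

/-- two `eqToHom`s with the same source and target are equal. [folklore] -/
private theorem eq_of_exists_eqToHom {X Y : C} {f g : X ⟶ Y} (hf : ∃ h, f = eqToHom h) (hg : ∃ h, g = eqToHom h) :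
    f = g := by
  obtain ⟨p, rfl⟩ := hf
  obtain ⟨q, rfl⟩ := hg
  rfl

end EqToHomLike

/-! ## The diagonal setting: the shifts are compatible with the family of strict commutations -/

namespace LogFrobeniusSetting

open DiagramOfCategories

variable (Vmod : Type u) (isArc : Vmod → Bool) (C : Type (u + 1)) [Category.{u} C]

/-- **At the diagonal setting every shift `shiftOneMorphism k` of `D•⊢` is compatible (Def 3.5 (v)) with the family of strict
commutations `diagonalFamily`**: the boundary set (ALL co-verticial pairs) is carried bijectively onto itself, and the
homotopies — `eqToHom`s — commute with the isomorphisms `Φ_{[γ]}` — `eqToHom`s as well, the 2-cells of the shift being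
identities. [cite: MochizukiAbsTopIII2015, Cor 5.5 (v) p. 132] -/
theorem nonempty_diagonalShiftCompatibleWith (k : ℤ) :
    Nonempty (((diagonal Vmod isArc C).shiftOneMorphism k).CompatibleWith (diagonalFamily Vmod isArc C)
      (diagonalFamily Vmod isArc C)) := by
  refine ⟨{ pathIso := fun p => ((diagonal Vmod isArc C).shiftOneMorphism k).pathIso p
            pathIso_nil := fun a => OneMorphism.pathIso_nil _ a
            pathIso_cons := fun p e => OneMorphism.pathIso_cons _ p e
            boundary_iff := fun _ _ => ⟨fun _ => trivial, fun _ => trivial⟩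
            boundary_surj := fun p' q' _ =>
              ⟨_, _, DVertex.shiftGraph_mapPath_cast k p', DVertex.shiftGraph_mapPath_cast k q'⟩
            η_compat := fun {a b} p q h => ?_ }⟩
  ext x
  obtain ⟨h₁, h₂, e₁, e₂⟩ := OneMorphism.exists_pathIso_hom_app_eq ((diagonal Vmod isArc C).shiftOneMorphism k)
    (fun e => (diagonal Vmod isArc C).shiftOneMorphism_iso_eq k e) p q x
  rw [NatTrans.comp_app, NatTrans.comp_app, Functor.whiskerLeft_app, Functor.whiskerRight_app, e₁, e₂]
  exact eq_of_exists_eqToHom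
    (exists_eqToHom_comp (exists_eqToHom_app ⟨diagonal_pathFunctor_eq Vmod isArc C _ _, rfl⟩ _) ⟨h₂, rfl⟩)
    (exists_eqToHom_comp ⟨h₁, rfl⟩
      (exists_eqToHom_map _ (exists_eqToHom_app ⟨diagonal_pathFunctor_eq Vmod isArc C _ _, rfl⟩ x)))

/-- **Total `□`-rigidity at the diagonal setting** (F-0155 / first conjunct of F-0156): it holds iff `C` is id-rigid
(abc-iut-w5-d112's `cor55CoreRigid_iff`; the named form of abc-iut-w4-d095's `exists_cor55CoreRigid_iff_isIdRigid`).
[cite: MochizukiAbsTopIII2015, Cor 5.5 (v) p. 133] -/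
theorem diagonal_cor55CoreRigid_iff : (diagonal Vmod isArc C).Cor55CoreRigid ↔ IsIdRigid C :=
  (diagonal Vmod isArc C).cor55CoreRigid_iff

end LogFrobeniusSetting

end Literature.AnabelianGeometry.AbsoluteAnabelian
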